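import Summits.CriticalPhenomena.PercolationContinuityZ3.Theorems.PercNearOneGluingNoHeavyLowerTailSahiGridPatternDiagCertBlockAndRouting

/-!
# `NoHeavyLowerTail` (crux stmt-CriticalPhenomena-4575), Sahi programme P1: **ROUTING CERTIFICATES, PART 1 — the V-block symbols of a section pair,
# formal linear forms, and the exact evaluation of the usage and diagonal-plan forms** (every S-block dimension `n`, every cell dimension `k`)

Support file (Sahi cell, seat `prim-sahi-p1`, generation 30; `--supports stmt-CriticalPhenomena-4575`).  Executable bookkeeping definitions + proofs; no `sorry`,
no `native_decide`; standard axioms.  Part 2 (`…SahiGridPatternRoutingCert`) adds the atom dictionary, the kernel-checkable certificate checker, its soundness,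
and the first instance (THEOREM BA₀ for the non-product top-cube set `↑{12,21}`).

THE MATHEMATICS (memo FROM-prim-sahi-p1-gen29-BLOCK-STEPS §3.2; census W120).  `S ⊆ [3]^n`, `V ⊆ [3]^k` up-sets, `A = S × V` (`glue ξ z ∈ A ↔ ξ ∈ S ∧ z ∈ V`),
`P, Q ⊆ [3]^{n+k}` up-sets with sections `P^ξ = {q : glue ξ q ∈ P}`.  For a pair `(ξ,η)` of S-block points the three V-BLOCK SYMBOLS are
  `n_a(ξ,η) = #{(q,r) tot. distinct : q ∈ V ∩ P^ξ, r ∈ Q^η}`,  `n_b(ξ,η) = #{… : q ∈ P^ξ, r ∈ V ∩ Q^η}`,  `ℓ(ξ,η) = #{… : q ∈ P^ξ, r ∈ Q^η, third(q,r) ∈ V}`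
(`routeSym V P Q i ξ η`, kinds `i = 0,1,2`), so that `Θ_V(P^ξ×Q^η) = n_a + n_b − ℓ` (`theta_sect_eq_routeSym`) and, by `thetaVal_blockAnd`,
  `Θ_A(P×Q) = Σ_{(ξ,η) tot. distinct, ζ third} [1_S(ξ) n_a(ξ,η) + 1_S(η) n_b(ξ,η) − 1_S(ζ) ℓ(ξ,η)]`  (**`routeEv_usage`**).
SIGN FACTS, every `k`, all up-sets `V, P, Q`: `κ_a = n_a − ℓ` is monotone in `η` and `κ_b = n_b − ℓ` in `ξ` (Kleitman in the cube around a cell,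
`sum_klCoef_ind_nonneg`: `routeKapA_mono`, `routeKapB_mono`), and second differences of `n_a, n_b, ℓ` over rectangles `(ξ,η) ≤ (ξ',η')` are `≥ 0`
(nested sections, `routeSymW_d2_nonneg`).  A FORMAL LINEAR FORM is `F : ℕ → [3]^n → [3]^n → ℤ`, evaluated by `routeEv` (linear: `routeEv_add/smul/sub`;
unit lists `routeListForm`, `routeEv_listForm`); the usage form `routeUsageB` and the diagonal-plan form `routePlanDiagB` (plan `μ = 2^n·diag(1_S)`) evaluate
to `Θ_A(P×Q)` and to `Σ_ξ 2^n 1_S(ξ) Θ_V(P^ξ×Q^ξ)` (`routeEv_planDiag`).  Nothing here asserts `PatternPos d` for `d ≥ 4`. [this work]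
-/

namespace Summit.CriticalPhenomena.PercolationContinuityZ3.Theorems.SahiGridPattern

open Finset SahiGrid3
open scoped BigOperators

variable {n k : ℕ}

/-! ### Two small facts about block products (local copies of `…DiagCertBlockAndT` / `…Theta`, not yet built on the farm when this file was checked) -/

/-- Indicator of a block product at a glued point (local copy). -/
private theorem ind_glue_blockAnd'' {S : Finset (Pd n)} {V : Finset (Pd k)} {A : Finset (Pd (n + k))}
    (hA : ∀ ξ z, glue ξ z ∈ A ↔ (ξ ∈ S ∧ z ∈ V)) (ξ : Pd n) (z : Pd k) : ind A (glue ξ z) = ind S ξ * ind V z := by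
  unfold ind; simp only [hA]; by_cases h1 : ξ ∈ S <;> by_cases h2 : z ∈ V <;> simp [h1, h2]

/-- `Θ` of a block product at glued points (local copy). -/
private theorem thetaVal_blockAnd'' {S : Finset (Pd n)} {V : Finset (Pd k)} {A : Finset (Pd (n + k))}
    (hA : ∀ ξ z, glue ξ z ∈ A ↔ (ξ ∈ S ∧ z ∈ V)) (ξ η : Pd n) (q r : Pd k) :
    thetaVal A (glue ξ q) (glue η r) = if (TotDist ξ η = true ∧ TotDist q r = true) then
        ind S ξ * ind V q + ind S η * ind V r - ind S (thirdPt ξ η) * ind V (thirdPt q r) else 0 := by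
  unfold thetaVal
  rw [thirdPt_glue, ind_glue_blockAnd'' hA, ind_glue_blockAnd'' hA, ind_glue_blockAnd'' hA]
  by_cases h : TotDist (glue ξ q) (glue η r) = true
  · rw [if_pos h, if_pos ((totDist_glue ξ η q r).1 h)]
  · have hn : ¬ (TotDist ξ η = true ∧ TotDist q r = true) := fun hh => h ((totDist_glue ξ η q r).2 hh)
    rw [if_neg h, if_neg hn]

/-- `Θ_A(P×Q)` as a four-fold indicator sum over the two blocks (local copy). -/
private theorem theta_pairs_eq_sum4' (A P Q : Finset (Pd (n + k))) : (∑ x ∈ P, ∑ y ∈ Q, thetaVal A x y) =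
    ∑ ξ : Pd n, ∑ q : Pd k, ∑ η : Pd n, ∑ r : Pd k, ind P (glue ξ q) * ind Q (glue η r) * thetaVal A (glue ξ q) (glue η r) := by
  rw [sum_sum_mem_eq_ind, sum_glue]
  refine Finset.sum_congr rfl fun ξ _ => Finset.sum_congr rfl fun q _ => ?_
  rw [sum_glue]

/-! ### The three V-block symbols of a section pair -/

/-- A weighted pair sum over the sections `P^ξ × Q^η`: `Σ_q Σ_r 1_P(glue ξ q) 1_Q(glue η r) w(q,r)`. [this work] -/
def routeSymW (P Q : Finset (Pd (n + k))) (w : Pd k → Pd k → ℤ) (ξ η : Pd n) : ℤ := ∑ q : Pd k, ∑ r : Pd k, ind P (glue ξ q) * ind Q (glue η r) * w q r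

/-- Weight of `n_a`: `[q δ̸ r]·1_V(q)`. [this work] -/
def routeWA (V : Finset (Pd k)) (q r : Pd k) : ℤ := if TotDist q r = true then ind V q else 0

/-- Weight of `n_b`: `[q δ̸ r]·1_V(r)`. [this work] -/
def routeWB (V : Finset (Pd k)) (q r : Pd k) : ℤ := if TotDist q r = true then ind V r else 0

/-- Weight of `ℓ`: `[q δ̸ r]·1_V(third(q,r))`. [this work] -/
def routeWL (V : Finset (Pd k)) (q r : Pd k) : ℤ := if TotDist q r = true then ind V (thirdPt q r) else 0

/-- The symbol of kind `i` (`0 ↦ n_a`, `1 ↦ n_b`, otherwise `ℓ`) at the section pair `(ξ,η)`. [this work] -/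
def routeSym (V : Finset (Pd k)) (P Q : Finset (Pd (n + k))) (i : ℕ) (ξ η : Pd n) : ℤ :=
  if i = 0 then routeSymW P Q (routeWA V) ξ η else if i = 1 then routeSymW P Q (routeWB V) ξ η else routeSymW P Q (routeWL V) ξ η

/-- The `n_a` weight is nonnegative. [this work] -/
theorem routeWA_nonneg (V : Finset (Pd k)) (q r : Pd k) : 0 ≤ routeWA V q r := by unfold routeWA; split_ifs; exacts [ind_nonneg' V q, le_rfl]

/-- The `n_b` weight is nonnegative. [this work] -/
theorem routeWB_nonneg (V : Finset (Pd k)) (q r : Pd k) : 0 ≤ routeWB V q r := by unfold routeWB; split_ifs; exacts [ind_nonneg' V r, le_rfl]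

/-- The `ℓ` weight is nonnegative. [this work] -/
theorem routeWL_nonneg (V : Finset (Pd k)) (q r : Pd k) : 0 ≤ routeWL V q r := by unfold routeWL; split_ifs; exacts [ind_nonneg' V _, le_rfl]

/-- Indicators of an up-set along nested glued points. [this work] -/
theorem ind_glue_mono {P : Finset (Pd (n + k))} (hP : IsUpperSet (P : Set (Pd (n + k)))) {ξ ξ' : Pd n} (h : ξ ≤ ξ') (q : Pd k) :
    ind P (glue ξ q) ≤ ind P (glue ξ' q) := ind_le_ind_of_imp fun hx => hP (glue_le_glue_iff.2 ⟨h, le_rfl⟩) hx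

/-- `Θ_V(P^ξ × Q^η) = n_a + n_b − ℓ`. [this work] -/
theorem theta_sect_eq_routeSym (V : Finset (Pd k)) (P Q : Finset (Pd (n + k))) (ξ η : Pd n) :
    (∑ q ∈ sect P ξ, ∑ r ∈ sect Q η, thetaVal V q r) = routeSym V P Q 0 ξ η + routeSym V P Q 1 ξ η - routeSym V P Q 2 ξ η := by
  unfold routeSym routeSymW routeWA routeWB routeWL
  simp only [if_true, show (1:ℕ) ≠ 0 by decide, show (2:ℕ) ≠ 0 by decide, show (2:ℕ) ≠ 1 by decide, if_false]
  rw [← Finset.sum_add_distrib, ← Finset.sum_sub_distrib, sum_mem_eq_sum_ind_mul]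
  refine Finset.sum_congr rfl fun q _ => ?_
  rw [← Finset.sum_add_distrib, ← Finset.sum_sub_distrib, sum_mem_eq_sum_ind_mul, Finset.mul_sum]
  refine Finset.sum_congr rfl fun r _ => ?_
  rw [ind_sect, ind_sect]; unfold thetaVal; split_ifs <;> ring

/-! ### Sign facts for the symbols (every `k`): second differences and Kleitman monotonicity -/

/-- Second differences of a weighted section-pair sum with `w ≥ 0` over a rectangle `(ξ,η) ≤ (ξ',η')` are nonnegative. [this work] -/
theorem routeSymW_d2_nonneg {P Q : Finset (Pd (n + k))} (hP : IsUpperSet (P : Set (Pd (n + k)))) (hQ : IsUpperSet (Q : Set (Pd (n + k))))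
    {w : Pd k → Pd k → ℤ} (hw : ∀ q r, 0 ≤ w q r) {ξ ξ' η η' : Pd n} (hξ : ξ ≤ ξ') (hη : η ≤ η') :
    0 ≤ routeSymW P Q w ξ' η' - routeSymW P Q w ξ η' - routeSymW P Q w ξ' η + routeSymW P Q w ξ η := by
  unfold routeSymW
  rw [← Finset.sum_sub_distrib, ← Finset.sum_sub_distrib, ← Finset.sum_add_distrib]
  refine Finset.sum_nonneg fun q _ => ?_
  rw [← Finset.sum_sub_distrib, ← Finset.sum_sub_distrib, ← Finset.sum_add_distrib]
  refine Finset.sum_nonneg fun r _ => ?_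
  have h1 := ind_glue_mono hP hξ q
  have h2 := ind_glue_mono hQ hη r
  have e : ind P (glue ξ' q) * ind Q (glue η' r) * w q r - ind P (glue ξ q) * ind Q (glue η' r) * w q r -
      ind P (glue ξ' q) * ind Q (glue η r) * w q r + ind P (glue ξ q) * ind Q (glue η r) * w q r =
      (ind P (glue ξ' q) - ind P (glue ξ q)) * (ind Q (glue η' r) - ind Q (glue η r)) * w q r := by ring
  rw [e]; exact mul_nonneg (mul_nonneg (by linarith) (by linarith)) (hw q r)

/-- `κ_a(ξ,η) = n_a − ℓ` as a `Q`-section sum of Kleitman column sums against the `P`-section. [this work] -/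
theorem routeKapA_eq (V : Finset (Pd k)) (P Q : Finset (Pd (n + k))) (ξ η : Pd n) :
    routeSymW P Q (routeWA V) ξ η - routeSymW P Q (routeWL V) ξ η = ∑ r : Pd k, ind Q (glue η r) * ∑ q : Pd k, klCoef V r q * ind P (glue ξ q) := by
  unfold routeSymW
  rw [← Finset.sum_sub_distrib]
  have e : (∑ q : Pd k, ((∑ r : Pd k, ind P (glue ξ q) * ind Q (glue η r) * routeWA V q r) - ∑ r : Pd k, ind P (glue ξ q) * ind Q (glue η r) * routeWL V q r)) =
      ∑ q : Pd k, ∑ r : Pd k, ind Q (glue η r) * (klCoef V r q * ind P (glue ξ q)) := by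
    refine Finset.sum_congr rfl fun q _ => ?_
    rw [← Finset.sum_sub_distrib]
    refine Finset.sum_congr rfl fun r _ => ?_
    unfold routeWA routeWL klCoef; split_ifs <;> ring
  rw [e, Finset.sum_comm]
  refine Finset.sum_congr rfl fun r _ => ?_
  rw [Finset.mul_sum]

/-- `κ_b(ξ,η) = n_b − ℓ` as a `P`-section sum of Kleitman column sums against the `Q`-section. [this work] -/
theorem routeKapB_eq (V : Finset (Pd k)) (P Q : Finset (Pd (n + k))) (ξ η : Pd n) :
    routeSymW P Q (routeWB V) ξ η - routeSymW P Q (routeWL V) ξ η = ∑ q : Pd k, ind P (glue ξ q) * ∑ r : Pd k, klCoef V q r * ind Q (glue η r) := by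
  unfold routeSymW
  rw [← Finset.sum_sub_distrib]
  refine Finset.sum_congr rfl fun q _ => ?_
  rw [← Finset.sum_sub_distrib, Finset.mul_sum]
  refine Finset.sum_congr rfl fun r _ => ?_
  unfold routeWB routeWL klCoef; rw [totDist_symm r q, thirdPt_comm r q]; split_ifs <;> ring

/-- **`κ_a` is monotone in `η`** (Kleitman, every `k`): `η ≤ η' ⟹ κ_a(ξ,η) ≤ κ_a(ξ,η')`. [this work] -/
theorem routeKapA_mono {V : Finset (Pd k)} (hV : IsUpperSet (V : Set (Pd k))) {P Q : Finset (Pd (n + k))} (hP : IsUpperSet (P : Set (Pd (n + k))))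
    (hQ : IsUpperSet (Q : Set (Pd (n + k)))) (ξ : Pd n) {η η' : Pd n} (hη : η ≤ η') :
    routeSymW P Q (routeWA V) ξ η - routeSymW P Q (routeWL V) ξ η ≤ routeSymW P Q (routeWA V) ξ η' - routeSymW P Q (routeWL V) ξ η' := by
  rw [routeKapA_eq, routeKapA_eq]
  exact Finset.sum_le_sum fun r _ => mul_le_mul_of_nonneg_right (ind_glue_mono hQ hη r) (sectNonneg_klCoef hV hP r ξ)

/-- **`κ_b` is monotone in `ξ`** (Kleitman, every `k`). [this work] -/
theorem routeKapB_mono {V : Finset (Pd k)} (hV : IsUpperSet (V : Set (Pd k))) {P Q : Finset (Pd (n + k))} (hP : IsUpperSet (P : Set (Pd (n + k))))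
    (hQ : IsUpperSet (Q : Set (Pd (n + k)))) {ξ ξ' : Pd n} (hξ : ξ ≤ ξ') (η : Pd n) :
    routeSymW P Q (routeWB V) ξ η - routeSymW P Q (routeWL V) ξ η ≤ routeSymW P Q (routeWB V) ξ' η - routeSymW P Q (routeWL V) ξ' η := by
  rw [routeKapB_eq, routeKapB_eq]
  exact Finset.sum_le_sum fun q _ => mul_le_mul_of_nonneg_right (ind_glue_mono hP hξ q) (sectNonneg_klCoef hV hQ q η)

/-! ### Formal linear forms in the three symbols and their evaluation -/

/-- Evaluation of a formal linear form `F : ℕ → [3]^n → [3]^n → ℤ` (kind `0,1,2` ↦ `n_a, n_b, ℓ`; other kinds ignored). [this work] -/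
def routeEv (V : Finset (Pd k)) (P Q : Finset (Pd (n + k))) (F : ℕ → Pd n → Pd n → ℤ) : ℤ :=
  ∑ i ∈ Finset.range 3, ∑ ξ : Pd n, ∑ η : Pd n, F i ξ η * routeSym V P Q i ξ η

/-- `routeEv` depends only on the values of the form. [this work] -/
theorem routeEv_congr {V : Finset (Pd k)} {P Q : Finset (Pd (n + k))} {F G : ℕ → Pd n → Pd n → ℤ} (h : ∀ i ξ η, F i ξ η = G i ξ η) :
    routeEv V P Q F = routeEv V P Q G := by unfold routeEv; simp only [h]

/-- `routeEv` only depends on the kinds `0, 1, 2`. [this work] -/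
theorem routeEv_congr3 {V : Finset (Pd k)} {P Q : Finset (Pd (n + k))} {F G : ℕ → Pd n → Pd n → ℤ} (h : ∀ i, i < 3 → ∀ ξ η, F i ξ η = G i ξ η) :
    routeEv V P Q F = routeEv V P Q G := by
  unfold routeEv
  refine Finset.sum_congr rfl fun i hi => ?_
  rw [Finset.mem_range] at hi; simp only [h i hi]

/-- `routeEv` is additive. [this work] -/
theorem routeEv_add (V : Finset (Pd k)) (P Q : Finset (Pd (n + k))) (F G : ℕ → Pd n → Pd n → ℤ) :
    routeEv V P Q (fun i ξ η => F i ξ η + G i ξ η) = routeEv V P Q F + routeEv V P Q G := by unfold routeEv; simp only [add_mul, Finset.sum_add_distrib]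

/-- `routeEv` is homogeneous. [this work] -/
theorem routeEv_smul (V : Finset (Pd k)) (P Q : Finset (Pd (n + k))) (c : ℤ) (F : ℕ → Pd n → Pd n → ℤ) :
    routeEv V P Q (fun i ξ η => c * F i ξ η) = c * routeEv V P Q F := by unfold routeEv; simp only [mul_assoc, Finset.mul_sum]

/-- `routeEv` respects subtraction. [this work] -/
theorem routeEv_sub (V : Finset (Pd k)) (P Q : Finset (Pd (n + k))) (F G : ℕ → Pd n → Pd n → ℤ) :
    routeEv V P Q (fun i ξ η => F i ξ η - G i ξ η) = routeEv V P Q F - routeEv V P Q G := by unfold routeEv; simp only [sub_mul, Finset.sum_sub_distrib]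

/-- A unit list: the formal form `Σ_u c_u · [kind = i_u, ξ = p_u, η = q_u]` of a list of weighted cells. [this work] -/
def routeListForm (L : List (ℤ × ℕ × Pd n × Pd n)) : ℕ → Pd n → Pd n → ℤ :=
  fun i ξ η => (L.map fun u => if (i = u.2.1 ∧ ξ = u.2.2.1 ∧ η = u.2.2.2) then u.1 else 0).sum

/-- Evaluation of one weighted cell. [this work] -/
theorem routeEv_cell (V : Finset (Pd k)) (P Q : Finset (Pd (n + k))) (c : ℤ) (i0 : ℕ) (p q : Pd n) :
    routeEv V P Q (fun i ξ η => if (i = i0 ∧ ξ = p ∧ η = q) then c else 0) = if i0 < 3 then c * routeSym V P Q i0 p q else 0 := by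
  unfold routeEv
  have hin : ∀ (i : ℕ) (ξ η : Pd n), (if (i = i0 ∧ ξ = p ∧ η = q) then c else 0) * routeSym V P Q i ξ η =
      if η = q then (if ξ = p then (if i = i0 then c * routeSym V P Q i0 p q else 0) else 0) else 0 := by
    intro i ξ η
    by_cases hi : i = i0
    · by_cases h1 : ξ = p
      · by_cases h2 : η = q
        · rw [if_pos ⟨hi, h1, h2⟩, if_pos h2, if_pos h1, if_pos hi, hi, h1, h2]
        · rw [if_neg (fun h => h2 h.2.2), if_neg h2, zero_mul]
      · rw [if_neg (fun h => h1 h.2.1)]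
        by_cases h2 : η = q
        · rw [if_pos h2, if_neg h1, zero_mul]
        · rw [if_neg h2, zero_mul]
    · rw [if_neg (fun h => hi h.1)]
      by_cases h2 : η = q
      · rw [if_pos h2]
        by_cases h1 : ξ = p
        · rw [if_pos h1, if_neg hi, zero_mul]
        · rw [if_neg h1, zero_mul]
      · rw [if_neg h2, zero_mul]
  have e1 : ∀ i : ℕ, (∑ ξ : Pd n, ∑ η : Pd n, (if (i = i0 ∧ ξ = p ∧ η = q) then c else 0) * routeSym V P Q i ξ η) =
      if i = i0 then c * routeSym V P Q i0 p q else 0 := by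
    intro i; simp only [hin, Finset.sum_ite_eq', Finset.mem_univ, if_true]
  simp only [e1]
  rw [Finset.sum_ite_eq']
  by_cases h3 : i0 < 3
  · rw [if_pos (Finset.mem_range.2 h3), if_pos h3]
  · rw [if_neg (fun h => h3 (Finset.mem_range.1 h)), if_neg h3]

/-- **Evaluation of a unit list** = the weighted sum of the symbols at its cells. [this work] -/
theorem routeEv_listForm (V : Finset (Pd k)) (P Q : Finset (Pd (n + k))) (L : List (ℤ × ℕ × Pd n × Pd n)) :
    routeEv V P Q (routeListForm L) = (L.map fun u => if u.2.1 < 3 then u.1 * routeSym V P Q u.2.1 u.2.2.1 u.2.2.2 else 0).sum := by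
  induction L with
  | nil => unfold routeEv routeListForm; simp
  | cons u L ih =>
    have hsplit : routeEv V P Q (routeListForm (u :: L)) =
        routeEv V P Q (fun i ξ η => (if (i = u.2.1 ∧ ξ = u.2.2.1 ∧ η = u.2.2.2) then u.1 else 0) + routeListForm L i ξ η) :=
      routeEv_congr fun i ξ η => by unfold routeListForm; rw [List.map_cons, List.sum_cons]
    rw [hsplit, routeEv_add, routeEv_cell, ih, List.map_cons, List.sum_cons]

/-! ### Usage and plan forms -/

/-- The sign of kind `i` in `Θ_V = n_a + n_b − ℓ`: `+1, +1, −1` (and `0` for unused kinds). [this work] -/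
def routeSign (i : ℕ) : ℤ := if i = 0 then 1 else if i = 1 then 1 else if i = 2 then -1 else 0

/-- Membership indicator through a Boolean membership function. [this work] -/
def indB (sb : Pd n → Bool) (ξ : Pd n) : ℤ := if sb ξ = true then 1 else 0

/-- The USAGE form of `S` (membership function `sb`): kind `0`: `[ξ δ̸ η]1_S(ξ)`; `1`: `[ξ δ̸ η]1_S(η)`; `2`: `−[ξ δ̸ η]1_S(ζ)` (`ζ` third). [this work] -/
def routeUsageB (sb : Pd n → Bool) : ℕ → Pd n → Pd n → ℤ := fun i ξ η =>
  (if TotDist ξ η = true then (1:ℤ) else 0) * (if i = 0 then indB sb ξ else if i = 1 then indB sb η else if i = 2 then -indB sb (thirdPt ξ η) else 0)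

/-- The form of the DIAGONAL plan `μ = 2^n·diag(1_S)`: `2^n·1_S(ξ)[ξ = η]·(n_a + n_b − ℓ)`. [this work] -/
def routePlanDiagB (n : ℕ) (sb : Pd n → Bool) : ℕ → Pd n → Pd n → ℤ := fun i ξ η => (if ξ = η then (2:ℤ) ^ n * indB sb ξ else 0) * routeSign i

/-- `1_S` through the Boolean membership function. [this work] -/
theorem ind_eq_indB {S : Finset (Pd n)} {sb : Pd n → Bool} (hsb : ∀ ξ, sb ξ = true ↔ ξ ∈ S) (ξ : Pd n) : ind S ξ = indB sb ξ := by
  unfold ind indB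
  by_cases h : ξ ∈ S
  · rw [if_pos h, if_pos ((hsb ξ).2 h)]
  · rw [if_neg h, if_neg (fun h' => h ((hsb ξ).1 h'))]

/-- Expanding `routeEv` over the three kinds. [this work] -/
theorem routeEv_eq_sum3 (V : Finset (Pd k)) (P Q : Finset (Pd (n + k))) (F : ℕ → Pd n → Pd n → ℤ) : routeEv V P Q F =
    ∑ ξ : Pd n, ∑ η : Pd n, (F 0 ξ η * routeSym V P Q 0 ξ η + F 1 ξ η * routeSym V P Q 1 ξ η + F 2 ξ η * routeSym V P Q 2 ξ η) := by
  unfold routeEv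
  rw [Finset.sum_range_succ, Finset.sum_range_succ, Finset.sum_range_succ, Finset.sum_range_zero, zero_add, ← Finset.sum_add_distrib, ← Finset.sum_add_distrib]
  refine Finset.sum_congr rfl fun ξ _ => ?_
  rw [← Finset.sum_add_distrib, ← Finset.sum_add_distrib]

/-- The usage form against the symbol weights, cell by cell: this is `Θ_{S×V}` at the glued pair (`thetaVal_blockAnd`). [this work] -/
theorem routeUsage_pointwise {S : Finset (Pd n)} {V : Finset (Pd k)} {A : Finset (Pd (n + k))} (hA : ∀ ξ z, glue ξ z ∈ A ↔ (ξ ∈ S ∧ z ∈ V))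
    {sb : Pd n → Bool} (hsb : ∀ ξ, sb ξ = true ↔ ξ ∈ S) (ξ η : Pd n) (q r : Pd k) :
    routeUsageB sb 0 ξ η * routeWA V q r + routeUsageB sb 1 ξ η * routeWB V q r + routeUsageB sb 2 ξ η * routeWL V q r = thetaVal A (glue ξ q) (glue η r) := by
  rw [thetaVal_blockAnd'' hA, ind_eq_indB hsb, ind_eq_indB hsb, ind_eq_indB hsb]
  unfold routeUsageB routeWA routeWB routeWL
  simp only [if_true, show (1:ℕ) ≠ 0 by decide, show (2:ℕ) ≠ 0 by decide, show (2:ℕ) ≠ 1 by decide, if_false]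
  by_cases h1 : TotDist ξ η = true
  · by_cases h2 : TotDist q r = true
    · simp only [h1, h2, and_self, if_true]; ring
    · simp [h2]
  · simp [h1]

/-- **Evaluation of the usage form is `Θ_{S×V}(P×Q)`.** [this work] -/
theorem routeEv_usage {S : Finset (Pd n)} {V : Finset (Pd k)} {A : Finset (Pd (n + k))} (hA : ∀ ξ z, glue ξ z ∈ A ↔ (ξ ∈ S ∧ z ∈ V))
    {sb : Pd n → Bool} (hsb : ∀ ξ, sb ξ = true ↔ ξ ∈ S) (P Q : Finset (Pd (n + k))) :
    routeEv V P Q (routeUsageB sb) = ∑ x ∈ P, ∑ y ∈ Q, thetaVal A x y := by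
  rw [theta_pairs_eq_sum4' A P Q, routeEv_eq_sum3]
  refine Finset.sum_congr rfl fun ξ _ => ?_
  rw [Finset.sum_comm]
  refine Finset.sum_congr rfl fun η _ => ?_
  unfold routeSym routeSymW
  simp only [if_true, show (1:ℕ) ≠ 0 by decide, show (2:ℕ) ≠ 0 by decide, show (2:ℕ) ≠ 1 by decide, if_false]
  rw [Finset.mul_sum, Finset.mul_sum, Finset.mul_sum, ← Finset.sum_add_distrib, ← Finset.sum_add_distrib]
  refine Finset.sum_congr rfl fun q _ => ?_
  rw [Finset.mul_sum, Finset.mul_sum, Finset.mul_sum, ← Finset.sum_add_distrib, ← Finset.sum_add_distrib]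
  refine Finset.sum_congr rfl fun r _ => ?_
  rw [← routeUsage_pointwise hA hsb ξ η q r]; ring

/-- **Evaluation of the diagonal plan form** = `Σ_ξ Σ_η [ξ=η]·2^n·1_S(ξ)·Θ_V(P^ξ × Q^η)`. [this work] -/
theorem routeEv_planDiag {S : Finset (Pd n)} {sb : Pd n → Bool} (hsb : ∀ ξ, sb ξ = true ↔ ξ ∈ S) (V : Finset (Pd k)) (P Q : Finset (Pd (n + k))) :
    routeEv V P Q (routePlanDiagB n sb) =
      ∑ ξ : Pd n, ∑ η : Pd n, (if ξ = η then (2:ℤ) ^ n * ind S ξ else 0) * ∑ q ∈ sect P ξ, ∑ r ∈ sect Q η, thetaVal V q r := by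
  rw [routeEv_eq_sum3]
  refine Finset.sum_congr rfl fun ξ _ => Finset.sum_congr rfl fun η _ => ?_
  rw [theta_sect_eq_routeSym, ind_eq_indB hsb]
  unfold routePlanDiagB routeSign
  simp only [if_true, show (1:ℕ) ≠ 0 by decide, show (2:ℕ) ≠ 0 by decide, show (2:ℕ) ≠ 1 by decide, if_false]
  ring

end Summit.CriticalPhenomena.PercolationContinuityZ3.Theorems.SahiGridPattern
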